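import Summits.QuantumFields.QCD.Theorems.LightQuarkCompletion.Negative.Anatomy
import Literature.MathematicalPhysics.QuantumFieldTheory.QCDGoldstoneBound

/-!
# Crux `LightQuarkCompletion` (stmt-QuantumFields-18066, route NestedDissectionSea, rank 6), negative side, 2/3 —
# line `Sketch`: the load-bearing hypotheses of its stubs

Support file of the standing disprover (cycle 1: refuter-cdisprove-stmt-QuantumFields-18066-0; cycle 2:
refuter-cdisprove-stmt-QuantumFields-18066-g2-0, 2026-08-17; extract of `Cruxes/LightQuarkCompletion/Disproof.lean` §4–§5,
§7).  NO refutation of the crux.  Sorry-free, standard axioms; every `def` is a statement abbreviation (a stub of the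
registered skeleton `Lines/Sketch.lean` verbatim, or a hypothesis-deleted variant, or a hypothesis `H`), nothing asserts a
Theses decl.

* §4 stub J (`stub_jumpLineIsChiral`): `stubJumpLineIsChiral_iff_not_exists` — J says EXACTLY that no regularisation of
  `N_f ∈ {2,3}` carries both scalings, `m_crit' → 0`, the zero-threshold two-sided pin, the body at every positive tuple AND one
  uniform lattice gap rate at all positive tuples (`UniformlyGappedZeroPinnedQCD`); and THE PIN IS LOAD-BEARING:
  `stubJumpLineIsChiral_false_without_pin` — modulo the believed-true, here unconstructible `UniformlyGappedBranchThresholdQCD`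
  (threshold QCD on the physical branch with one gap rate above its threshold) J with the pin deleted is FALSE, the countermodel
  being the RGI up-shift of the H-regularisation by its own threshold (it keeps both scalings, `m_crit → 0` and the body at
  every positive tuple, and is provably not chiral at zero).  So `m_crit' → 0` is NOT what excludes shifted countermodels.
* §5 stub B2b (`stub_physicalBranch`): `stubPhysicalBranch_false_without_body_and_lowerPins` — UNCONDITIONALLY false once the
  body and both LOWER pins are deleted (heavy junk `m_crit ≡ 1`: both scalings, weak branch, every upper pin for free by Seiler
  positivity, `m_crit ↛ 0`): the location of the line comes from a lower pin or from the body, never from upper pins + scalings.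
* §7 stub B2a (`stub_jumpGerm`): `stubJumpGerm_false_without_body_and_lowerPin` — UNCONDITIONALLY false once the body and the
  threshold lower pin are deleted: no subsequence / re-centring of the heavy junk regularisation carries a zero-threshold LOWER
  pin (its pin mass tends to `1 ∉ (−8, 0)`, `PinClause.mass_mem_Ioo`).  The germ is manufactured from the threshold lower pin or
  the body — never from upper pins.
-/

noncomputable section

open scoped BigOperators Classical
open MeasureTheory Filter Topology Matrix
open Literature.MathematicalPhysics.QuantumLattice Literature.MathematicalPhysics.QuantumFieldTheory
  Literature.Probability.LatticeModels
open Summit.QuantumFields.QCD.Theses.NestedDissectionSea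
open Summit.QuantumFields.QCD.Theorems.CoerciveSeaNegative
open Summit.QuantumFields.QCD.Theorems.EarlyCrosserLawNegative

namespace Summit.QuantumFields.QCD.Theorems.LightQuarkCompletion.Negative

variable {Nf : ℕ}

/-! ## §4 Stub J (`stub_jumpLineIsChiral`): exact content, and the zero-threshold pin is load-bearing -/

/-- **Stub J, VERBATIM** the registered signature of `LightQuarkJumpLine.stub_jumpLineIsChiral` (line `Sketch`).  Statement
abbreviation (OPEN; not asserted). -/
def StubJumpLineIsChiral : Prop :=
  ∀ Nf : ℕ, (Nf = 2 ∨ Nf = 3) → ∀ reg' : QCDRegularisation Nf,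
    reg'.HasMassScaling → (reg'.scheme 0 0 0).HasAsymptoticScaling → Tendsto reg'.mcrit atTop (𝓝 0) →
    (∀ m : Fin Nf → ℝ, (∀ f, 0 < m f) → ∃ R : ℝ, 0 < R ∧ PinClause Nf reg' 0 m R ∧ UpperPin Nf reg' 0 m R) →
    (∀ m : Fin Nf → ℝ, (∀ f, 0 < m f) → ∃ (z shift : QCDField Nf → ℕ → ℝ) (T : OSData (QCDField Nf) 4),
      IsQCDAlong (reg'.scheme m z shift) T ∧ T.IsNontrivial QCDField.glue ∧ T.IsNonGaussian QCDField.glue ∧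
        (∀ f g : Fin Nf, f ≠ g → T.IsNontrivial (QCDField.pseudoRe f g)) ∧
          ∃ Δ > 0, T.HasMassGap Δ ∧ (reg'.scheme m z shift).HasLatticeMassGap Δ) →
    reg'.IsChiralAtZero

/-- Stub J over the abbreviations `PinPkg` / `Body` of `Anatomy.lean` (definitional). -/
theorem stubJumpLineIsChiral_iff :
    StubJumpLineIsChiral ↔ ∀ Nf : ℕ, (Nf = 2 ∨ Nf = 3) → ∀ reg' : QCDRegularisation Nf,
      reg'.HasMassScaling → (reg'.scheme 0 0 0).HasAsymptoticScaling → Tendsto reg'.mcrit atTop (𝓝 0) →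
        PinPkg Nf reg' 0 → Body Nf reg' 0 → reg'.IsChiralAtZero :=
  Iff.rfl

/-- **Uniformly gapped, zero-threshold-pinned, all-masses QCD at `N_f`** — the object whose NON-existence stub J asserts: a
regularisation with both scalings, `m_crit' → 0`, the two-sided pin at zero threshold, the body at every positive tuple, and ONE
lattice gap rate `ε > 0` at every positive tuple.  Statement abbreviation (believed EMPTY for `N_f ≥ 2` — Goldstone; believed
INHABITED for `N_f = 1` if pinned one-flavour QCD exists). [topic constructive-qft] -/
def UniformlyGappedZeroPinnedQCD (Nf : ℕ) : Prop :=
  ∃ reg' : QCDRegularisation Nf, reg'.HasMassScaling ∧ (reg'.scheme 0 0 0).HasAsymptoticScaling ∧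
    Tendsto reg'.mcrit atTop (𝓝 0) ∧ PinPkg Nf reg' 0 ∧ Body Nf reg' 0 ∧
      ∃ ε > (0 : ℝ), ∀ m : Fin Nf → ℝ, (∀ f, 0 < m f) → (reg'.scheme m 0 0).HasLatticeMassGap ε

/-- **Stub J is EXACTLY a non-existence statement**: J holds iff for `N_f ∈ {2,3}` no uniformly gapped zero-threshold-pinned
all-masses QCD exists (`¬ IsChiralAtZero` unfolds to a uniform gap rate at every positive tuple).  So a proof of J must turn the
pin + body into gaplessness as `m → 0⁺`; a disproof must CONSTRUCT the pinned object with a uniform gap. -/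
theorem stubJumpLineIsChiral_iff_not_exists :
    StubJumpLineIsChiral ↔ ∀ Nf : ℕ, (Nf = 2 ∨ Nf = 3) → ¬ UniformlyGappedZeroPinnedQCD Nf := by
  rw [stubJumpLineIsChiral_iff]
  constructor
  · rintro h Nf hNf ⟨reg', hMS, hAS, hlim, hpin, hbody, ε, hε, hgap⟩
    obtain ⟨m, hm, hno⟩ := h Nf hNf reg' hMS hAS hlim hpin hbody ε hε
    exact hno (hgap m hm)
  · intro h Nf hNf reg' hMS hAS hlim hpin hbody
    by_contra hχ
    refine h Nf hNf ⟨reg', hMS, hAS, hlim, hpin, hbody, ?_⟩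
    simp only [QCDRegularisation.IsChiralAtZero, not_forall, not_exists, not_and, not_not] at hχ
    obtain ⟨ε, hε, hall⟩ := hχ
    exact ⟨ε, hε, fun m hm => hall m hm⟩

/-- **Stub J with the zero-threshold pin DELETED.**  Statement abbreviation; FALSE modulo `UniformlyGappedBranchThresholdQCD`,
see `stubJumpLineIsChiral_false_without_pin`. -/
def StubJumpLineIsChiralWithoutPin : Prop :=
  ∀ Nf : ℕ, (Nf = 2 ∨ Nf = 3) → ∀ reg' : QCDRegularisation Nf,
    reg'.HasMassScaling → (reg'.scheme 0 0 0).HasAsymptoticScaling → Tendsto reg'.mcrit atTop (𝓝 0) →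
      Body Nf reg' 0 → reg'.IsChiralAtZero

/-- **H — uniformly gapped threshold QCD on the physical branch** (believed TRUE, not constructible in the tree): some
regularisation with both scalings and `m_crit → 0` carries the `QCDOf` body above a threshold `M₀ ≥ 0` AND has ONE lattice gap
rate `ε > 0` at every tuple above `M₀` (heavier quarks do not close the gap).  It is the crux's own hypothesis package with the pin
replaced by `m_crit → 0` plus mass-uniformity of the gap — the expected shape of every honest output of `SeaFactorisationBridge`.
[topic constructive-qft] -/
def UniformlyGappedBranchThresholdQCD (Nf : ℕ) : Prop :=
  ∃ reg : QCDRegularisation Nf, reg.HasMassScaling ∧ (reg.scheme 0 0 0).HasAsymptoticScaling ∧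
    Tendsto reg.mcrit atTop (𝓝 0) ∧ ∃ M₀ : ℝ, 0 ≤ M₀ ∧ Body Nf reg M₀ ∧
      ∃ ε > (0 : ℝ), ∀ m : Fin Nf → ℝ, (∀ f, M₀ < m f) → (reg.scheme m 0 0).HasLatticeMassGap ε

/-- **A uniform gap above `M₀` refutes chirality of every up-shift by `D ≥ M₀`** (the shifted scheme at a positive tuple `m` is
the original scheme at `D + m`, all components `> M₀`). -/
theorem not_isChiralAtZero_upShift_of_uniformGapAbove (reg : QCDRegularisation Nf) {M₀ ε D : ℝ} (hε : 0 < ε)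
    (hgap : ∀ m : Fin Nf → ℝ, (∀ f, M₀ < m f) → (reg.scheme m 0 0).HasLatticeMassGap ε) (hD : M₀ ≤ D) :
    ¬ (upShift reg D).IsChiralAtZero := by
  intro hχ
  obtain ⟨m, hm, hno⟩ := hχ ε hε
  apply hno
  rw [upShift_scheme]
  exact hgap _ fun f => by linarith [hm f]

/-- **Every hypothesis of J except the pin is blind to RGI up-shifts of a threshold regularisation**: from both scalings,
`m_crit → 0` and the body above `M₀`, the up-shift by any `D ≥ M₀` has both scalings, `m_crit → 0` and the body at EVERY positive
tuple (`N_f ≤ 16`) — while its pin, if `reg` had one above `M₀`, is only certified above `M₀ + D` (`pinPkg_upShift`). -/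
theorem jHypsMinusPin_upShift (hNf : Nf ≤ 16) (reg : QCDRegularisation Nf) {M₀ D : ℝ} (hD : M₀ ≤ D)
    (hMS : reg.HasMassScaling) (hAS : (reg.scheme 0 0 0).HasAsymptoticScaling) (hlim : Tendsto reg.mcrit atTop (𝓝 0))
    (hbody : Body Nf reg M₀) :
    (upShift reg D).HasMassScaling ∧ ((upShift reg D).scheme 0 0 0).HasAsymptoticScaling ∧
      Tendsto (upShift reg D).mcrit atTop (𝓝 0) ∧ Body Nf (upShift reg D) 0 :=
  ⟨(hasMassScaling_upShift reg D).mpr hMS, (hasAsymptoticScaling_upShift reg D).mpr hAS,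
    tendsto_mcrit_upShift reg D hNf hMS hlim, body_upShift (M₁ := 0) (by linarith) hbody⟩

/-- **THE PIN IS LOAD-BEARING IN STUB J (modulo H).**  If uniformly gapped threshold QCD on the physical branch exists at
`N_f ∈ {2,3}`, then stub J with its zero-threshold pin deleted is FALSE: the up-shift of the H-regularisation by its threshold
`M₀` has both scalings, `m_crit → 0` and the body at every positive tuple, and is NOT chiral at zero.  Hence any proof of J uses
the pin; and since the countermodel has `m_crit → 0`, the hypothesis `Tendsto reg'.mcrit atTop (𝓝 0)` is NOT what excludes it. -/
theorem stubJumpLineIsChiral_false_without_pin (hNf : Nf = 2 ∨ Nf = 3) (H : UniformlyGappedBranchThresholdQCD Nf) :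
    ¬ StubJumpLineIsChiralWithoutPin := by
  intro hJ
  obtain ⟨reg, hMS, hAS, hlim, M₀, hM₀, hbody, ε, hε, hgap⟩ := H
  have hNf16 : Nf ≤ 16 := by rcases hNf with rfl | rfl <;> norm_num
  obtain ⟨hMS', hAS', hlim', hbody'⟩ := jHypsMinusPin_upShift hNf16 reg le_rfl hMS hAS hlim hbody
  exact not_isChiralAtZero_upShift_of_uniformGapAbove reg hε hgap le_rfl (hJ Nf hNf (upShift reg M₀) hMS' hAS' hlim' hbody')

/-- The same up-shift read against the FULL stub J: it satisfies every hypothesis but is certified to carry the pin only above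
`2M₀` (from a pin above `M₀`), never at `0` — J is consistent with H exactly because its pin is at ZERO threshold. -/
theorem upShift_pin_only_above (reg : QCDRegularisation Nf) {M₀ : ℝ} (hM₀ : 0 ≤ M₀) (hpin : PinPkg Nf reg M₀) :
    PinPkg Nf (upShift reg M₀) (M₀ + M₀) :=
  pinPkg_upShift hM₀ hpin

/-! ## §5 Stub B2b (`stub_physicalBranch`): scalings + weak branch + UPPER pins do not locate the line

Stub B2b concludes `m_crit → 0` for a threshold regularisation whose re-centring at some germ carries the zero-threshold pin.
Deleting the body AND both LOWER pins (the threshold one and the re-centred one) leaves a FALSE statement: along the heavy junk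
regularisation `heavyJunkReg 2` (`canonicalAF` with `m_crit ≡ 1`, both scalings, weak branch trivially) every upper pin holds
OUTRIGHT — its indicator is empty by Seiler positivity at positive bare mass — while `m_crit ≡ 1 ↛ 0`.  So B2b's information
"the line is near `0`, not in `[−1, 0)` and not at `+1`" must come from a LOWER pin or from the body (non-decoupled dynamical
quarks / IsQCDAlong); cf. the sibling fact `FrameAndSeparatorLawNegative.frameWithoutLowerPin_false` for the frame (α). -/

/-- **The upper pin is free wherever its mass is positive** (Seiler positivity empties the indicator; any `reg`, tuple, `R`). -/
theorem upperPin_of_pos_mass (reg : QCDRegularisation Nf) {M₀ : ℝ} (m : Fin Nf → ℝ) (R : ℝ)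
    (hpos : ∀ M : ℝ, M₀ < M → ∀ k : ℕ, 0 < reg.mcrit k + reg.a k * M / reg.Zm k) : UpperPin Nf reg M₀ m R := by
  intro M hM
  refine Filter.Eventually.of_forall fun k S _hS _hS2 => ?_
  dsimp only
  have hp : ∀ U : GaugeConfig 4 (2 * S + 1) (Matrix.specialUnitaryGroup (Fin 3) ℂ),
      ¬ (fermionDet (wilsonDirac (fundamentalRep (Fin 3)) U (reg.mcrit k + reg.a k * M / reg.Zm k) 1)).re < 0 :=
    fun U => not_lt.mpr (fermionDet_wilsonDirac_re_pos (fundamentalRep (Fin 3))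
      fundamentalRep_mem_unitaryGroup U (hpos M hM k)).le
  simp [hp]

/-- **Stub B2b with the body and both LOWER pins deleted** (upper pins, scalings, weak branch kept; the re-centred
regularisation written exactly as in the registered signature).  Statement abbreviation; FALSE. -/
def StubPhysicalBranchWithoutBodyAndLowerPins : Prop :=
  ∀ Nf : ℕ, (Nf = 2 ∨ Nf = 3) → ∀ reg : QCDRegularisation Nf, reg.HasMassScaling →
    (reg.scheme 0 0 0).HasAsymptoticScaling → (∀ᶠ k : ℕ in atTop, -1 ≤ reg.mcrit k) → ∀ M₀ : ℝ, 0 ≤ M₀ →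
    (∀ m : Fin Nf → ℝ, (∀ f, M₀ < m f) → ∃ R : ℝ, 0 < R ∧ UpperPin Nf reg M₀ m R) →
    ∀ J : ℝ, (∀ m : Fin Nf → ℝ, (∀ f, 0 < m f) → ∃ R : ℝ, 0 < R ∧
      UpperPin Nf (QCDRegularisation.mk reg.a reg.a_pos reg.tendsto_a reg.β reg.L reg.tendsto_L
        (fun k => reg.mcrit k + reg.a k * J / reg.Zm k) reg.Zm reg.Zm_pos) 0 m R) →
    Tendsto reg.mcrit atTop (𝓝 0)

/-- **B2b needs the body or a lower pin**: `StubPhysicalBranchWithoutBodyAndLowerPins` is FALSE (witness `heavyJunkReg 2`,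
germ `J = 0`). [folklore] -/
theorem stubPhysicalBranch_false_without_body_and_lowerPins : ¬ StubPhysicalBranchWithoutBodyAndLowerPins := by
  intro h
  obtain ⟨hms, has, M₀, hM₀, b₀, -, ℓ, -, hm⟩ := withoutLowerPinAt_heavyJunkReg 2
  have hbr : ∀ᶠ k : ℕ in atTop, -1 ≤ (heavyJunkReg 2).mcrit k :=
    Filter.Eventually.of_forall fun k => by
      show (-1 : ℝ) ≤ 1
      norm_num
  have hup : ∀ m : Fin 2 → ℝ, (∀ f, M₀ < m f) → ∃ R : ℝ, 0 < R ∧ UpperPin 2 (heavyJunkReg 2) M₀ m R :=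
    fun m hmm => by
      obtain ⟨R, hR, -, hu⟩ := hm m hmm
      exact ⟨R, hR, hu⟩
  have hup0 : ∀ m : Fin 2 → ℝ, (∀ f, 0 < m f) → ∃ R : ℝ, 0 < R ∧
      UpperPin 2 (QCDRegularisation.mk (heavyJunkReg 2).a (heavyJunkReg 2).a_pos (heavyJunkReg 2).tendsto_a
        (heavyJunkReg 2).β (heavyJunkReg 2).L (heavyJunkReg 2).tendsto_L
        (fun k => (heavyJunkReg 2).mcrit k + (heavyJunkReg 2).a k * 0 / (heavyJunkReg 2).Zm k)
        (heavyJunkReg 2).Zm (heavyJunkReg 2).Zm_pos) 0 m R := fun m _ =>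
    ⟨1, one_pos, upperPin_of_pos_mass _ m 1 fun M hM k => by
      have ha := (heavyJunkReg 2).a_pos k
      have hZ := (heavyJunkReg 2).Zm_pos k
      have h1 : (heavyJunkReg 2).mcrit k = 1 := rfl
      show 0 < (heavyJunkReg 2).mcrit k + (heavyJunkReg 2).a k * 0 / (heavyJunkReg 2).Zm k +
        (heavyJunkReg 2).a k * M / (heavyJunkReg 2).Zm k
      rw [h1]
      positivity⟩
  have hT : Tendsto (heavyJunkReg 2).mcrit atTop (𝓝 0) :=
    h 2 (Or.inl rfl) (heavyJunkReg 2) hms has hbr M₀ hM₀ hup 0 hup0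
  have h1 : Tendsto (heavyJunkReg 2).mcrit atTop (𝓝 1) := tendsto_const_nhds
  have h01 := tendsto_nhds_unique hT h1
  norm_num at h01

/-! ## §7 Stub B2a (`stub_jumpGerm`): the germ is manufactured from the threshold LOWER pin or the body, never from upper pins

Stub B2a concludes, from the threshold package, a subsequence `φ` and a germ `J` such that the reindexed regularisation
re-centred at `J` carries BOTH zero-threshold pins.  Deleting the body and the threshold LOWER pin leaves a FALSE statement
(witness again `heavyJunkReg 2`, which carries every upper pin for free): the conclusion contains a zero-threshold LOWER pin,
whose pin mass must eventually lie in `(−8, 0)` (`PinClause.mass_mem_Ioo`), whereas along any subsequence and any re-centring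
of the heavy junk regularisation that mass is `1 + a_{φ k}(J − M)/Z_m(φ k) → 1`.  (With the threshold lower pin kept, B2a at
`M₀ = 0` is PROVED — `LightQuarkJumpLine.jumpGerm_of_zeroThreshold`, `φ = id`, `J = 0`; for `M₀ > 0` it is open, and by the
pin clash of the companion file `PinClash.lean` its germ is confined to `[−M₀, M₀]` only modulo radius compatibility.) -/

/-- **Stub B2a with the body and the threshold LOWER pin deleted** (both scalings, weak branch, threshold upper pins kept;
conclusion verbatim: BOTH zero-threshold pins of the reindexed re-centred regularisation).  Statement abbreviation; FALSE. -/
def StubJumpGermWithoutBodyAndLowerPin : Prop :=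
  ∀ Nf : ℕ, (Nf = 2 ∨ Nf = 3) → ∀ reg : QCDRegularisation Nf, reg.HasMassScaling →
    (reg.scheme 0 0 0).HasAsymptoticScaling → (∀ᶠ k : ℕ in atTop, -1 ≤ reg.mcrit k) → ∀ M₀ : ℝ, 0 ≤ M₀ →
    (∀ m : Fin Nf → ℝ, (∀ f, M₀ < m f) → ∃ R : ℝ, 0 < R ∧ UpperPin Nf reg M₀ m R) →
    ∃ (φ : ℕ → ℕ) (hφ : StrictMono φ) (J : ℝ), ∀ m : Fin Nf → ℝ, (∀ f, 0 < m f) → ∃ R : ℝ, 0 < R ∧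
      PinClause Nf (QCDRegularisation.mk (reg.restrict φ hφ.tendsto_atTop).a (reg.restrict φ hφ.tendsto_atTop).a_pos
        (reg.restrict φ hφ.tendsto_atTop).tendsto_a (reg.restrict φ hφ.tendsto_atTop).β (reg.restrict φ hφ.tendsto_atTop).L
        (reg.restrict φ hφ.tendsto_atTop).tendsto_L (fun k => (reg.restrict φ hφ.tendsto_atTop).mcrit k +
          (reg.restrict φ hφ.tendsto_atTop).a k * J / (reg.restrict φ hφ.tendsto_atTop).Zm k)
        (reg.restrict φ hφ.tendsto_atTop).Zm (reg.restrict φ hφ.tendsto_atTop).Zm_pos) 0 m R ∧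
      UpperPin Nf (QCDRegularisation.mk (reg.restrict φ hφ.tendsto_atTop).a (reg.restrict φ hφ.tendsto_atTop).a_pos
        (reg.restrict φ hφ.tendsto_atTop).tendsto_a (reg.restrict φ hφ.tendsto_atTop).β (reg.restrict φ hφ.tendsto_atTop).L
        (reg.restrict φ hφ.tendsto_atTop).tendsto_L (fun k => (reg.restrict φ hφ.tendsto_atTop).mcrit k +
          (reg.restrict φ hφ.tendsto_atTop).a k * J / (reg.restrict φ hφ.tendsto_atTop).Zm k)
        (reg.restrict φ hφ.tendsto_atTop).Zm (reg.restrict φ hφ.tendsto_atTop).Zm_pos) 0 m R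

/-- **B2a needs the threshold lower pin or the body**: `StubJumpGermWithoutBodyAndLowerPin` is FALSE (witness `heavyJunkReg 2`:
the concluded zero-threshold lower pin at `M = 1` would put `1 + a_{φ k}(J − 1)/Z_m(φ k)` eventually in `(−8, 0)`, but this
tends to `1`). [folklore] -/
theorem stubJumpGerm_false_without_body_and_lowerPin : ¬ StubJumpGermWithoutBodyAndLowerPin := by
  intro h
  obtain ⟨hms, has, M₀, hM₀, b₀, -, ℓ, -, hm⟩ := withoutLowerPinAt_heavyJunkReg 2
  have hbr : ∀ᶠ k : ℕ in atTop, -1 ≤ (heavyJunkReg 2).mcrit k :=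
    Filter.Eventually.of_forall fun k => by
      show (-1 : ℝ) ≤ 1
      norm_num
  have hup : ∀ m : Fin 2 → ℝ, (∀ f, M₀ < m f) → ∃ R : ℝ, 0 < R ∧ UpperPin 2 (heavyJunkReg 2) M₀ m R :=
    fun m hmm => by
      obtain ⟨R, hR, -, hu⟩ := hm m hmm
      exact ⟨R, hR, hu⟩
  obtain ⟨φ, hφ, J, hJ⟩ := h 2 (Or.inl rfl) (heavyJunkReg 2) hms has hbr M₀ hM₀ hup
  obtain ⟨R, -, hlo, -⟩ := hJ (fun _ => 1) (fun _ => one_pos)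
  -- the concluded lower pin at `M = 1` puts its mass eventually in `(−8, 0)`
  have hIoo := hlo.mass_mem_Ioo (M := 1) one_pos
  -- but `a_{φ k}/Z_m(φ k) → 0`, so that mass `1 + (a/Z)(φ k)·(J − 1)` is eventually positive
  have haz : Tendsto (fun k => (heavyJunkReg 2).a (φ k) / (heavyJunkReg 2).Zm (φ k)) atTop (𝓝 0) :=
    (tendsto_a_div_Zm (heavyJunkReg 2) hms (massExponent_pos (by norm_num))).comp hφ.tendsto_atTop
  have hsmall : ∀ᶠ k in atTop, |(heavyJunkReg 2).a (φ k) / (heavyJunkReg 2).Zm (φ k) * (J - 1)| < 1 := by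
    have h0 : Tendsto (fun k => (heavyJunkReg 2).a (φ k) / (heavyJunkReg 2).Zm (φ k) * (J - 1)) atTop (𝓝 0) := by
      simpa using haz.mul_const (J - 1)
    have := h0.abs
    simp only [abs_zero] at this
    exact this.eventually (gt_mem_nhds one_pos)
  obtain ⟨k, hk1, hk2⟩ := (hIoo.and hsmall).exists
  have hmc : (heavyJunkReg 2).mcrit (φ k) = 1 := rfl
  simp only [QCDRegularisation.restrict_a, QCDRegularisation.restrict_mcrit, QCDRegularisation.restrict_Zm,
    Function.comp_apply, hmc, Set.mem_Ioo] at hk1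
  have hlt := (abs_lt.mp hk2).1
  have heq : (1 : ℝ) + (heavyJunkReg 2).a (φ k) * J / (heavyJunkReg 2).Zm (φ k) -
      (heavyJunkReg 2).a (φ k) * 1 / (heavyJunkReg 2).Zm (φ k) =
        1 + (heavyJunkReg 2).a (φ k) / (heavyJunkReg 2).Zm (φ k) * (J - 1) := by ring
  rw [heq] at hk1
  linarith [hk1.2]

end Summit.QuantumFields.QCD.Theorems.LightQuarkCompletion.Negative

end
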